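import Summits.MatrixMultiplication.MatrixMultiplication.Theses.OctonionicLaser
import Summits.MatrixMultiplication.MatrixMultiplication.Theorems.OctonionicLaserDefs
import Summits.MatrixMultiplication.MatrixMultiplication.Theorems.OctonionicLaserOctAsymptoticRankStubOctonionBasis
import Summits.MatrixMultiplication.MatrixMultiplication.Theorems.OctonionicLaserOctAsymptoticRankMilestonesIff

/-!
# Crux `OctAsymptoticRank` (stmt-MatrixMultiplication-7930) — `Lines/birth.lean`, reshaped after wave 1

Route `OctonionicLaser`; the crux is `OctAsymptoticRank : R̃(t₈) = asymptoticRank (octT ℂ) ≤ 8`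
(Strassen's asymptotic rank conjecture for the complex-octonion tensor `t₈`).

## State of the line (lead prover-line-stmt-MatrixMultiplication-7930-0, 2026-08-17)

* `stub_octonionBasis` (transfer `𝕊 ≥ t₈`) — **LANDED** (p147453,
  `Theorems/OctonionicLaserOctAsymptoticRankStubOctonionBasis.lean`: kernel certificate over `ℤ[i]`
  + `GaussianInt.toComplex`).  No longer a stub.
* converse transfer `t₈ ≥ 𝕊` and the exactness of the currency change — **LANDED**
  (`Theorems/OctonionicLaserOctAsymptoticRankMilestonesIff.lean`: `octT_restrictsTo_signedTable`,
  `algBorderRank_kroneckerPow_signedTable_eq`, `asymptoticRank_signedTable_eq`,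
  `octAsymptoticRank_iff_signedTable_milestones : OctAsymptoticRank ↔ milestones(𝕊)`): the one
  remaining stub is now PROVABLY EQUIVALENT to the crux — it is the crux in certifiable
  (border-rank-of-powers) currency, neither weaker nor stronger.
* `stub_powerMilestones` — OPEN; it is the whole open problem.  Known data at `k = 1`:
  `14 ≤ bR(t₈) ≤ R(t₈) ≤ 26` — lower bound `OctKoszulFourteen`; upper bound LANDED by this line
  (`Theorems/OctonionicLaserOctAsymptoticRankRankTwentySeven.lean`, p169198: an explicit 27-term algorithm
  over `ℚ(i)`; `…RankTwentySix.lean`, p170978, LANDED: 26 terms over `ℚ(i, √2)`, the Clifford part `Cl₃ ≅ M₂ ⊕ M₂`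
  absorbing one sign-defect entry at rank `14`), against the naive `28` of four Strassen products; complex
  ALS finds nothing at `25` terms (kit j023931), so `26` is plausibly the rank.  Nothing proved at `k ≥ 2`,
  `bR(t₈^{⊠k}) ≥ 8^k + 1` for every `k` (route header: critical tensors + Albert isotopy), so the
  quantifier order `∀ δ ∃ k` is essential.  Any `T ≳ t₈` must have all quantum functionals `≥ 8`
  (those of `t₈` are `8`), which rules out cheap sources such as `⟨2,2,2⟩ ⊠ W` (min quantum functional
  `4 · 2^{h(1/3)} = 7.56`); the only unobstructed sources known are `⟨2,2,2⟩ ⊠ ⟨2⟩`-type (circular in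
  `ω`) and unit tensors (= the rank milestones themselves).

The composition is now one line: the crux BY NAME from the single declared stub through the landed
equivalence.
-/

-- `Summit.<Summit>.<Problem>`: for the single-conjunct summit the duplicate component is mandated.
set_option linter.dupNamespace false

noncomputable section

namespace Summit.MatrixMultiplication.MatrixMultiplication.Cruxes.OctAsymptoticRank.Birth

open Summit.MatrixMultiplication.MatrixMultiplication.Theorems.OctAsymptoticRank
  (octAsymptoticRank_iff_signedTable_milestones)

/-! ## The one registered stub -/

/-- **Stub — border-rank power milestones of the signed table** (the engine; the crux in certifiable
currency, provably equivalent to it by `octAsymptoticRank_iff_signedTable_milestones`): for every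
`δ > 0` some Kronecker power `𝕊^{⊠k}`, `k ≥ 1`, of the signed `𝔽₂³` octonion table has algebraic
border rank (over `ℂ[ε]`, Bläser 2013 Def. 6.1) at most `(8(1+δ))^k`.  Size XL / open (Strassen 1988
asymptotic rank conjecture, instance `t₈`; any proof gives `ω ≤ 2.0817` via the proved `OctLaserBound`).
Sources: Strassen1988, ChristandlVranaZuiddam2023, BurgisserClausenShokrollahi1997 (Lemma 15.27,
Problem 15.5), ConnerGesmundoLandsbergVentura2022, Blaser2013 (Def. 6.1, Thm. 6.6). -/
theorem stub_powerMilestones :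
    ∀ δ : ℝ, 0 < δ → ∃ k : ℕ, 1 ≤ k ∧
      (Literature.Computability.AlgebraicComplexity.algBorderRank
          (Literature.Computability.AlgebraicComplexity.kroneckerPow
            (fun z x y : Fin 2 × Fin 2 × Fin 2 =>
              if z = x + y then
                (if x.1 * y.1 + x.1 * y.2.1 + x.1 * y.2.2 + x.2.1 * y.2.1 + x.2.1 * y.2.2 + x.2.2 * y.2.2
                      + y.1 * x.2.1 * x.2.2 + x.1 * y.2.1 * x.2.2 + x.1 * x.2.1 * y.2.2 = (1 : Fin 2)
                  then (-1 : ℂ) else (1 : ℂ))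
              else (0 : ℂ)) k) : ℝ)
        ≤ ((8 : ℝ) * (1 + δ)) ^ k := by
  sorry

/-! ## The composition: the stub proves the crux BY NAME -/

/-- **THE SKELETON THEOREM.** The crux
`Summit.MatrixMultiplication.MatrixMultiplication.Theses.OctonionicLaser.OctAsymptoticRank`
(stmt-MatrixMultiplication-7930), concluded BY NAME from the single declared stub
`stub_powerMilestones` through the landed equivalence
`octAsymptoticRank_iff_signedTable_milestones` (which packages the landed transfer `𝕊 ≥ t₈`,
`R̃(t₈) ≤ R̃(𝕊)`, `R̃(𝕊)^k ≤ R̃(𝕊^{⊠k}) ≤ bR(𝕊^{⊠k})` and `δ → 0`). [folklore] -/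
theorem OctAsymptoticRank_of :
    Summit.MatrixMultiplication.MatrixMultiplication.Theses.OctonionicLaser.OctAsymptoticRank :=
  octAsymptoticRank_iff_signedTable_milestones.mpr stub_powerMilestones

end Summit.MatrixMultiplication.MatrixMultiplication.Cruxes.OctAsymptoticRank.Birth

end
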